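import Literature.Probability.RandomPlanarGeometry.SAWCountMonotoneEven
import Literature.Probability.RandomPlanarGeometry.BDGS2012Prop13
import Literature.Probability.LatticeModels.LatticeGraphProofs
import HarnessLib

/-!
# Monotonicity `cₙ ≤ cₙ₊₁` (O'Brien 1990) for every ODD `n ≤ 6d - 5`, hence for all `n ≤ 6d - 4`:
# no doubly trapped walk of odd length below `6d - 3`

Sequel of `SAWCountMonotoneEven.lean` (even lengths: `T₂ = doublyTrapped d n = ∅` for even `n ≤ 8d - 8`)
and of `SAWCountMonotoneUpToFourD.lean` (`n ≤ 4d`).  For ODD `n` the neighbours of a trapped end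
`e = ω n` are visited at EVEN times and the neighbours of the start at ODD times, so the two cages do
not compete for times; instead they interact through the geometry of `ℤ^d`:

* the `2d` neighbours of `e` occupy `2d` of the `(n+1)/2` even times `< n`; call the other
  `m = (n+1)/2 - 2d` even times *exceptional*;
* an odd time `j < n` whose two even neighbours `j ± 1` are both cage times of `e` (a *generic* time)
  has `ω j` adjacent to two neighbours of `e`; if moreover `ω j ∼ 0`, then
  - when `e ∼ 0`: `0`, `ω (j-1)`, `ω (j+1)` are three common neighbours of `e` and `ω j`, so
    (`eq_or_eq_of_adj_adj`: at most two) `ω (j-1) = 0` and `j = 1`;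
  - when `e ≁ 0` (so `‖e‖₁ ≥ 2`): `ω (j ± 1)` are neighbours of `e` inside the `ℓ¹`-ball of radius `2`,
    and there are at most three such sites (`card_filter_nbrs_normOne_le_two_le`), while three generic
    times would supply four of them;
  either way at most two odd times `j` (counting also `j = n` when `e ∼ 0`) are generic-or-final with
  `ω j ∼ 0`;
* every other odd time with `ω j ∼ 0` is next to an exceptional even time: at most `2m` of them.
So a start with at most one free neighbour (`≥ 2d - 1` visited neighbours, all at odd times) forces
`2d - 1 ≤ 2m + 2 = n + 3 - 4d`, i.e. **`6d - 3 ≤ n`** (`n` odd).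

* `normOne_eq_zero_iff`, `adj_zero_iff_normOne_eq_one`, `normOne_adj_cases` (a lattice step changes
  `‖·‖₁` by exactly one), `card_filter_nbrs_normOne_succ_le` (at most `‖e‖₁` neighbours of `e` are
  closer to the origin), `card_filter_nbrs_normOne_le_two_le` (for `‖e‖₁ ≥ 2` at most three neighbours
  of `e` lie in the `ℓ¹`-ball of radius `2`);
* `doublyTrapped_eq_empty_of_odd` : **`T₂ = ∅` for every odd `n ≤ 6d - 5`** (all `d`);
* `count_le_count_succ_of_odd` : `cₙ ≤ cₙ₊₁` for every odd `n ≤ 6d - 5`;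
* `count_le_count_succ_of_le_six_mul` : **`cₙ ≤ cₙ₊₁` for ALL `n ≤ 6d - 4`, in every dimension `d ≥ 1`**
  (with the even file; `d = 3`: `n ≤ 14`, and the even lengths `16` by the even file; `d = 4`:
  `n ≤ 20`; this supersedes the range `n ≤ 4d` of `SAWCountMonotoneUpToFourD.lean` for `d ≥ 3`).

Both thresholds are sharp in `d = 2` and in `d = 3` (exact enumeration, lane «pcv-sawmu», not used in any proof):
on `ℤ²`, `6d - 3 = 9` and `8d - 6 = 10` are the first odd and even lengths with doubly trapped walks (the
`9`-step walk `0, e₁, e₁+e₂, e₂, e₂-e₁, e₂-2e₁, -2e₁, -2e₁-e₂, -e₁-e₂, -e₁` ends at the neighbour `-e₁` of the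
origin, enclosed, with the single free start site `-e₂`); on `ℤ³` the `15`-step walk `0, -e₁, -e₁+e₂, e₂,
e₁+e₂, 2e₁+e₂, 2e₁, 2e₁+e₃, e₁+e₃, e₃, e₃-e₂, -e₂, e₁-e₂, e₁-e₂-e₃, e₁-e₃, e₁` (`6d - 3 = 15`) and the `18`-step
walk `0, e₁, 2e₁, 2e₁+e₂, 2e₁+2e₂, e₁+2e₂, 2e₂, e₂, e₂+e₃, e₁+e₂+e₃, e₁+e₃, e₃, e₃-e₁, -e₁, -e₁-e₃, -e₃, e₁-e₃,
e₁+e₂-e₃, e₁+e₂` (`8d - 6 = 18`) are doubly trapped (end enclosed, exactly one free site at the start).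
The general inequality is O'Brien's theorem, the tree's named fact `BDGS2012_count_mono`.

[cite: MadrasSlade1993, §1.1; §1.2 (p. 10: sites at times of different parity are distinct); §7.1]
[cite: BDGS2012, §1.1, eq. (1.1) (`‖x‖₁`); §1.3 (`cₙ ≤ cₙ₊₁`, O'Brien 1990)]
-/

noncomputable section

open Literature.Probability.LatticeModels Literature.Probability.Percolation SimpleGraph
open scoped BigOperators

namespace Literature.Probability.RandomPlanarGeometry.SAW.Zd

variable {d : ℕ}

/-! ### `ℓ¹` steps on `ℤ^d` -/

/-- `‖x‖₁ = 0` iff `x = 0`. [cite: BDGS2012, §1.1, eq. (1.1)] -/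
theorem normOne_eq_zero_iff {x : Site d} : normOne x = 0 ↔ x = 0 := by
  constructor
  · intro h
    funext i
    exact Int.natAbs_eq_zero.1 (Finset.sum_eq_zero_iff.1 h i (Finset.mem_univ i))
  · rintro rfl; exact normOne_zero

/-- `x ∼ 0` iff `‖x‖₁ = 1` (the tree's `zdGraph_adj_iff_norm`, recast for `normOne`).
[cite: BDGS2012, §1.1, eq. (1.1)] -/
theorem adj_zero_iff_normOne_eq_one {x : Site d} : (zdGraph d).Adj 0 x ↔ normOne x = 1 := by
  rw [zdGraph_adj_iff_norm_holds]
  have hcast : ((normOne x : ℕ) : ℤ) = ∑ i, |(0 : Site d) i - x i| := by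
    unfold normOne
    push_cast
    refine Finset.sum_congr rfl fun i _ => ?_
    simp
  constructor
  · intro h; exact_mod_cast hcast.trans h
  · intro h; rw [← hcast, h]; rfl

/-- Changing one coordinate: `‖x‖₁ + |eᵢ| = ‖e‖₁ + |xᵢ|` when `x` and `e` agree off `i` (`‖x‖₁ = Σᵢ |xᵢ|`).
[cite: BDGS2012, §1.1, eq. (1.1)] -/
theorem normOne_add_natAbs_eq {e x : Site d} {i : Fin d} (h : ∀ k, k ≠ i → x k = e k) :
    normOne x + (e i).natAbs = normOne e + (x i).natAbs := by
  classical
  unfold normOne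
  rw [← Finset.add_sum_erase _ (fun k => (x k).natAbs) (Finset.mem_univ i),
    ← Finset.add_sum_erase _ (fun k => (e k).natAbs) (Finset.mem_univ i)]
  have : ∑ k ∈ Finset.univ.erase i, (x k).natAbs = ∑ k ∈ Finset.univ.erase i, (e k).natAbs :=
    Finset.sum_congr rfl fun k hk => by rw [h k (Finset.mem_erase.1 hk).1]
  rw [this]; ring

/-- A neighbour `x` of `e` is `e` with one coordinate changed by `± 1`. [cite: MadrasSlade1993, §1.1] -/
theorem exists_apply_eq_of_adj {e x : Site d} (h : (zdGraph d).Adj e x) :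
    ∃ i : Fin d, (∀ k, k ≠ i → x k = e k) ∧ (x i = e i + 1 ∨ x i = e i - 1) := by
  obtain ⟨i, hi | hi⟩ := (zdGraph_adj_iff e x).1 h
  · refine ⟨i, fun k hk => ?_, Or.inl ?_⟩
    · rw [hi, Pi.add_apply, Pi.single_eq_of_ne hk, add_zero]
    · rw [hi, Pi.add_apply, Pi.single_eq_same]
  · refine ⟨i, fun k hk => ?_, Or.inr ?_⟩
    · have := congrFun hi k
      rw [Pi.add_apply, Pi.single_eq_of_ne hk, add_zero] at this
      rw [this]
    · have := congrFun hi i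
      rw [Pi.add_apply, Pi.single_eq_same] at this
      rw [this]; ring

/-- **A lattice step changes `‖·‖₁` by exactly one.** [cite: BDGS2012, §1.1, eq. (1.1)] -/
theorem normOne_adj_cases {e x : Site d} (h : (zdGraph d).Adj e x) :
    normOne x + 1 = normOne e ∨ normOne x = normOne e + 1 := by
  obtain ⟨i, hk, hi⟩ := exists_apply_eq_of_adj h
  have := normOne_add_natAbs_eq hk
  rcases hi with hi | hi <;> rw [hi] at this <;> omega

/-- A neighbour of `e` that is closer to the origin is `e - sgn(eᵢ) eᵢ` for a nonzero coordinate `i`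
of `e`. [cite: MadrasSlade1993, §1.1] -/
theorem filter_nbrs_normOne_succ_subset_image (e : Site d) :
    ((nbrs e).filter fun x => normOne x + 1 = normOne e) ⊆
      ((Finset.univ : Finset (Fin d)).filter fun i => e i ≠ 0).image
        fun i => e - Pi.single i (Int.sign (e i)) := by
  intro x hx
  rw [Finset.mem_filter, mem_nbrs] at hx
  obtain ⟨hadj, hnorm⟩ := hx
  obtain ⟨i, hk, hi⟩ := exists_apply_eq_of_adj hadj
  have hsum := normOne_add_natAbs_eq hk
  have hxi : e i ≠ 0 ∧ x i = e i - Int.sign (e i) := by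
    rcases hi with hi | hi
    · rw [hi] at hsum ⊢
      have hneg : e i < 0 := by omega
      exact ⟨hneg.ne, by rw [Int.sign_eq_neg_one_of_neg hneg]; ring⟩
    · rw [hi] at hsum ⊢
      have hpos : 0 < e i := by omega
      exact ⟨hpos.ne', by rw [Int.sign_eq_one_of_pos hpos]⟩
  refine Finset.mem_image.2 ⟨i, Finset.mem_filter.2 ⟨Finset.mem_univ i, hxi.1⟩, ?_⟩
  funext k
  by_cases hki : k = i
  · rw [hki, Pi.sub_apply, Pi.single_eq_same, hxi.2]
  · rw [Pi.sub_apply, Pi.single_eq_of_ne hki, sub_zero, hk k hki]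

/-- A site has at most `‖e‖₁` nonzero coordinates. [cite: BDGS2012, §1.1, eq. (1.1)] -/
theorem card_filter_apply_ne_zero_le_normOne (e : Site d) :
    ((Finset.univ : Finset (Fin d)).filter fun i => e i ≠ 0).card ≤ normOne e := by
  calc ((Finset.univ : Finset (Fin d)).filter fun i => e i ≠ 0).card
      = ∑ i ∈ (Finset.univ : Finset (Fin d)).filter (fun i => e i ≠ 0), 1 :=
        Finset.card_eq_sum_ones _
    _ ≤ ∑ i ∈ (Finset.univ : Finset (Fin d)).filter (fun i => e i ≠ 0), (e i).natAbs :=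
        Finset.sum_le_sum fun i hi =>
          Nat.one_le_iff_ne_zero.2 (Int.natAbs_ne_zero.2 (Finset.mem_filter.1 hi).2)
    _ ≤ ∑ i, (e i).natAbs := Finset.sum_le_sum_of_subset_of_nonneg (Finset.filter_subset _ _)
        fun _ _ _ => Nat.zero_le _

/-- **At most `‖e‖₁` neighbours of `e` are closer to the origin** (they are the sites
`e - sgn(eᵢ) eᵢ` over the nonzero coordinates `i` of `e`, and there are at most `‖e‖₁` of those).
[cite: MadrasSlade1993, §1.1] -/
theorem card_filter_nbrs_normOne_succ_le (e : Site d) :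
    ((nbrs e).filter fun x => normOne x + 1 = normOne e).card ≤ normOne e :=
  (Finset.card_le_card (filter_nbrs_normOne_succ_subset_image e)).trans
    (Finset.card_image_le.trans (card_filter_apply_ne_zero_le_normOne e))

/-- **For `‖e‖₁ ≥ 2`, at most three neighbours of `e` lie in the `ℓ¹`-ball of radius `2` around the
origin**: such a neighbour is one step closer to the origin than `e` (a step away has `‖·‖₁ ≥ 3`), so
`‖e‖₁ ≤ 3` once there is one, and `card_filter_nbrs_normOne_succ_le` applies.
[cite: MadrasSlade1993, §1.1] -/
theorem card_filter_nbrs_normOne_le_two_le {e : Site d} (he : 2 ≤ normOne e) :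
    ((nbrs e).filter fun x => normOne x ≤ 2).card ≤ 3 := by
  classical
  set Q := (nbrs e).filter fun x => normOne x ≤ 2 with hQ
  have hQT : ∀ x ∈ Q, normOne x + 1 = normOne e := by
    intro x hx
    rw [hQ, Finset.mem_filter, mem_nbrs] at hx
    rcases normOne_adj_cases hx.1 with h | h
    · exact h
    · omega
  rcases Q.eq_empty_or_nonempty with h | ⟨x₀, hx₀⟩
  · rw [h]; simp
  have he3 : normOne e ≤ 3 := by
    have := hQT x₀ hx₀
    have := (Finset.mem_filter.1 hx₀).2
    omega
  have hsub : Q ⊆ (nbrs e).filter fun x => normOne x + 1 = normOne e := fun x hx =>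
    Finset.mem_filter.2 ⟨(Finset.mem_filter.1 hx).1, hQT x hx⟩
  exact (Finset.card_le_card hsub).trans ((card_filter_nbrs_normOne_succ_le e).trans he3)

/-! ### No doubly trapped walk of odd length below `6d - 3` -/

/-- There are at most `(n + 1) / 2` even natural numbers below `n` (the times of one parity used in the parity count
of Madras–Slade §1.2). [cite: MadrasSlade1993, §1.2, p. 10] -/
theorem card_filter_range_even_le (n : ℕ) :
    ((Finset.range n).filter fun i => i % 2 = 0).card ≤ (n + 1) / 2 := by
  have hmaps : ∀ i ∈ (Finset.range n).filter (fun i => i % 2 = 0),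
      i / 2 ∈ Finset.range ((n + 1) / 2) := by
    intro i hi
    rw [Finset.mem_filter, Finset.mem_range] at hi
    rw [Finset.mem_range]; omega
  have hinj : Set.InjOn (fun i => i / 2) ((Finset.range n).filter fun i => i % 2 = 0 : Set ℕ) := by
    intro i hi i' hi' h
    rw [Finset.mem_coe, Finset.mem_filter] at hi hi'
    simp only at h; omega
  have := Finset.card_le_card_of_injOn (fun i => i / 2) hmaps hinj
  rwa [Finset.card_range] at this

/-- **No doubly trapped walk of odd length `n ≤ 6d - 5`.** See the module docstring for the
argument (cage times of the trapped end at even times, exceptional even times, generic odd times and the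
two geometric facts `eq_or_eq_of_adj_adj`, `card_filter_nbrs_normOne_le_two_le`).
[cite: MadrasSlade1993, §1.2, p. 10; §7.1] [cite: BDGS2012, §1.3] -/
theorem doublyTrapped_eq_empty_of_odd {n : ℕ} (hodd : Odd n) (hn : n + 5 ≤ 6 * d) :
    doublyTrapped d n = ∅ := by
  classical
  refine Finset.eq_empty_of_forall_notMem fun ω hωT => ?_
  obtain ⟨hω, h0, h1⟩ := mem_doublyTrapped.1 hωT
  obtain ⟨h00, -, hadj, hinj⟩ := mem_saws.1 hω
  have hn2 : n % 2 = 1 := Nat.odd_iff.1 hodd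
  have hn7 : 4 * d ≤ n + 1 := four_mul_le_of_extCount_eq_zero hω h0
  have hinj' : ∀ i ≤ n, ∀ j ≤ n, ω i = ω j → i = j := fun i hi j hj h =>
    hinj (show i ∈ {i | i ≤ n} from hi) (show j ∈ {i | i ≤ n} from hj) h
  -- even times `< n`: cage times `EN` of the trapped end and exceptional times `X`
  set P := (Finset.range n).filter fun i => i % 2 = 0 with hP
  set EN := P.filter fun i => (zdGraph d).Adj (ω n) (ω i) with hEN
  set X := P.filter fun i => ¬ (zdGraph d).Adj (ω n) (ω i) with hX
  have hPcard : P.card ≤ (n + 1) / 2 := card_filter_range_even_le n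
  have hENX : EN.card + X.card = P.card := by
    rw [hEN, hX, Finset.card_filter_add_card_filter_not]
  have hENcard : 2 * d ≤ EN.card := by
    have hsub : nbrs (ω n) ⊆ EN.image ω := by
      intro y hy
      have hy' := mem_nbrs.1 hy
      have hvis : ∃ i ≤ n, ω i = y := by
        by_contra h
        have : y ∈ freeNbrs ω n := mem_freeNbrs.2 ⟨hy', fun i hi hiy => h ⟨i, hi, hiy⟩⟩
        rw [extCount, Finset.card_eq_zero] at h0
        rw [h0] at this
        exact Finset.notMem_empty y this
      obtain ⟨i, hi, rfl⟩ := hvis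
      have hin : i ≠ n := fun h => hy'.ne (by rw [h])
      have hpar := odd_add_of_adj_apply hω hi hy'
      refine Finset.mem_image.2 ⟨i, ?_, rfl⟩
      rw [hEN, Finset.mem_filter, hP, Finset.mem_filter, Finset.mem_range]
      exact ⟨⟨by omega, by omega⟩, hy'⟩
    calc 2 * d = (nbrs (ω n)).card := (card_nbrs _).symm
      _ ≤ (EN.image ω).card := Finset.card_le_card hsub
      _ ≤ EN.card := Finset.card_image_le
  -- the visited neighbours of the start and their (odd) times `B`
  set U := (nbrs (ω 0)).filter fun z => ∀ i ≤ n, ω i ≠ z with hU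
  set W := (nbrs (ω 0)).filter fun z => ¬ ∀ i ≤ n, ω i ≠ z with hW
  have hUW : U.card + W.card = 2 * d := by
    rw [hU, hW, Finset.card_filter_add_card_filter_not, card_nbrs]
  have hU1 : U.card ≤ 1 := (card_filter_nbrs_start_le_extCount_revWalk hω).trans h1
  set B := (Finset.range (n + 1)).filter fun j => (zdGraph d).Adj (ω 0) (ω j) with hB
  have hBmem : ∀ j ∈ B, j ≤ n ∧ j % 2 = 1 ∧ (zdGraph d).Adj (ω 0) (ω j) := by
    intro j hj
    rw [hB, Finset.mem_filter, Finset.mem_range] at hj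
    have hpar := odd_add_of_adj_apply_apply hω (Nat.zero_le n) (by omega : j ≤ n) hj.2
    exact ⟨by omega, by omega, hj.2⟩
  have hWB : W.card ≤ B.card := by
    have hsub : W ⊆ B.image ω := by
      intro z hz
      rw [hW, Finset.mem_filter] at hz
      obtain ⟨hz, hvis⟩ := hz
      have hex : ∃ i ≤ n, ω i = z := by
        by_contra h; exact hvis fun i hi hiz => h ⟨i, hi, hiz⟩
      obtain ⟨j, hj, rfl⟩ := hex
      refine Finset.mem_image.2 ⟨j, ?_, rfl⟩
      rw [hB, Finset.mem_filter, Finset.mem_range]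
      exact ⟨by omega, mem_nbrs.1 hz⟩
    exact (Finset.card_le_card hsub).trans Finset.card_image_le
  -- split `B`: the final time `n`, generic times, special times
  set Bf := B.filter fun j => ¬ j < n with hBf
  set Bl := B.filter fun j => j < n with hBl
  have hBsplit : Bl.card + Bf.card = B.card := by
    rw [hBl, hBf, Finset.card_filter_add_card_filter_not]
  set G := Bl.filter fun j => (zdGraph d).Adj (ω n) (ω (j - 1)) ∧ (zdGraph d).Adj (ω n) (ω (j + 1))
    with hG
  set Sp := Bl.filter fun j =>
    ¬ ((zdGraph d).Adj (ω n) (ω (j - 1)) ∧ (zdGraph d).Adj (ω n) (ω (j + 1))) with hSp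
  have hBlsplit : G.card + Sp.card = Bl.card := by
    rw [hG, hSp, Finset.card_filter_add_card_filter_not]
  -- special times sit next to exceptional even times: at most `2 #X` of them
  set Sp₁ := Bl.filter fun j => ¬ (zdGraph d).Adj (ω n) (ω (j - 1)) with hSp₁
  set Sp₂ := Bl.filter fun j => ¬ (zdGraph d).Adj (ω n) (ω (j + 1)) with hSp₂
  have hBlmem : ∀ j ∈ Bl, j < n ∧ j % 2 = 1 ∧ (zdGraph d).Adj (ω 0) (ω j) := by
    intro j hj
    rw [hBl, Finset.mem_filter] at hj
    obtain ⟨-, hpar, ha⟩ := hBmem j hj.1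
    exact ⟨hj.2, hpar, ha⟩
  have hSpU : Sp.card ≤ Sp₁.card + Sp₂.card := by
    refine (Finset.card_le_card fun j hj => ?_).trans (Finset.card_union_le Sp₁ Sp₂)
    rw [hSp, Finset.mem_filter, not_and_or] at hj
    rcases hj.2 with h | h
    · exact Finset.mem_union_left _ (Finset.mem_filter.2 ⟨hj.1, h⟩)
    · exact Finset.mem_union_right _ (Finset.mem_filter.2 ⟨hj.1, h⟩)
  have hSp₁X : Sp₁.card ≤ X.card := by
    refine Finset.card_le_card_of_injOn (fun j => j - 1) (fun j hj => ?_) ?_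
    · rw [Finset.mem_coe, hSp₁, Finset.mem_filter] at hj
      obtain ⟨hjn, hpar, -⟩ := hBlmem j hj.1
      show j - 1 ∈ (X : Set ℕ)
      rw [Finset.mem_coe, hX, Finset.mem_filter, hP, Finset.mem_filter, Finset.mem_range]
      exact ⟨⟨by omega, by omega⟩, hj.2⟩
    · intro j hj j' hj' h
      rw [Finset.mem_coe, hSp₁, Finset.mem_filter] at hj hj'
      have := (hBlmem j hj.1).2.1
      have := (hBlmem j' hj'.1).2.1
      simp only at h; omega
  have hSp₂X : Sp₂.card ≤ X.card := by
    refine Finset.card_le_card_of_injOn (fun j => j + 1) (fun j hj => ?_) ?_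
    · rw [Finset.mem_coe, hSp₂, Finset.mem_filter] at hj
      obtain ⟨hjn, hpar, -⟩ := hBlmem j hj.1
      show j + 1 ∈ (X : Set ℕ)
      rw [Finset.mem_coe, hX, Finset.mem_filter, hP, Finset.mem_filter, Finset.mem_range]
      exact ⟨⟨by omega, by omega⟩, hj.2⟩
    · intro j _ j' _ h
      simpa using h
  -- generic times (and the final time when `ω n ∼ 0`): at most two
  have hGmem : ∀ j ∈ G, j < n ∧ j % 2 = 1 ∧ (zdGraph d).Adj (ω 0) (ω j) ∧
      (zdGraph d).Adj (ω n) (ω (j - 1)) ∧ (zdGraph d).Adj (ω n) (ω (j + 1)) := by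
    intro j hj
    rw [hG, Finset.mem_filter] at hj
    obtain ⟨hjn, hpar, ha⟩ := hBlmem j hj.1
    exact ⟨hjn, hpar, ha, hj.2.1, hj.2.2⟩
  have hGBf : G.card + Bf.card ≤ 2 := by
    by_cases h0n : (zdGraph d).Adj (ω 0) (ω n)
    · -- `e ∼ 0`: the final time counts once, and the only generic time is `j = 1`
      have hBf1 : Bf.card ≤ 1 := by
        refine (Finset.card_le_card fun j hj => ?_).trans (Finset.card_singleton n).le
        rw [hBf, Finset.mem_filter] at hj
        have := (hBmem j hj.1).1
        exact Finset.mem_singleton.2 (by omega)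
      have hG1 : G.card ≤ 1 := by
        refine (Finset.card_le_card fun j hj => ?_).trans (Finset.card_singleton 1).le
        obtain ⟨hjn, hpar, ha, hm, hp⟩ := hGmem j hj
        rw [Finset.mem_singleton]
        obtain ⟨k, rfl⟩ : ∃ k, j = k + 1 := ⟨j - 1, by omega⟩
        simp only [Nat.add_sub_cancel] at hm
        by_contra hk1
        have hxy : ω n ≠ ω (k + 1) := fun h => by
          have := hinj' n le_rfl (k + 1) (by omega) h; omega
        have hzk : (zdGraph d).Adj (ω k) (ω (k + 1)) := hadj k (by omega)
        have hzk2 : (zdGraph d).Adj (ω (k + 1 + 1)) (ω (k + 1)) := (hadj (k + 1) (by omega)).symm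
        rcases eq_or_eq_of_adj_adj hxy h0n.symm ha hm hzk with h | h
        · have := hinj' k (by omega) 0 (Nat.zero_le n) h; omega
        rcases eq_or_eq_of_adj_adj hxy h0n.symm ha hp hzk2 with h' | h'
        · have := hinj' (k + 1 + 1) (by omega) 0 (Nat.zero_le n) h'; omega
        · have := hinj' k (by omega) (k + 1 + 1) (by omega) (h.trans h'.symm); omega
      omega
    · -- `e ≁ 0`: no final time; generic times give neighbours of `e` in the ball of radius two
      have hBf0 : Bf.card = 0 := by
        rw [Finset.card_eq_zero, Finset.eq_empty_iff_forall_notMem]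
        intro j hj
        rw [hBf, Finset.mem_filter] at hj
        obtain ⟨hjle, -, ha⟩ := hBmem j hj.1
        have : j = n := by omega
        subst this
        exact h0n ha
      have hne0 : ω n ≠ 0 := fun h => by
        have := hinj' n le_rfl 0 (Nat.zero_le n) (h.trans h00.symm); omega
      have he2 : 2 ≤ normOne (ω n) := by
        by_contra hlt
        rcases Nat.lt_or_ge (normOne (ω n)) 1 with h | h
        · exact hne0 (normOne_eq_zero_iff.1 (by omega))
        · exact h0n (by rw [h00]; exact adj_zero_iff_normOne_eq_one.2 (by omega))
      set Q := (nbrs (ω n)).filter fun x => normOne x ≤ 2 with hQ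
      have hQ3 : Q.card ≤ 3 := card_filter_nbrs_normOne_le_two_le he2
      -- the sites `ω (j ± 1)` for generic `j` lie in `Q`
      have hnormj : ∀ j ∈ G, normOne (ω j) = 1 := by
        intro j hj
        have := adj_zero_iff_normOne_eq_one.1 (h00 ▸ (hGmem j hj).2.2.1)
        exact this
      have hQmem : ∀ j ∈ G, ω (j - 1) ∈ Q ∧ ω (j + 1) ∈ Q := by
        intro j hj
        obtain ⟨hjn, hpar, ha, hm, hp⟩ := hGmem j hj
        have h1 := hnormj j hj
        obtain ⟨k, rfl⟩ : ∃ k, j = k + 1 := ⟨j - 1, by omega⟩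
        simp only [Nat.add_sub_cancel] at hm ⊢
        have hsm := normOne_adj_cases ((hadj k (by omega)).symm)
        have hsp := normOne_adj_cases (hadj (k + 1) (by omega))
        refine ⟨Finset.mem_filter.2 ⟨mem_nbrs.2 hm, by omega⟩,
          Finset.mem_filter.2 ⟨mem_nbrs.2 hp, by omega⟩⟩
      have hG2 : G.card ≤ 2 := by
        rcases G.eq_empty_or_nonempty with hGe | hGne
        · rw [hGe]; simp
        set j₀ := G.min' hGne with hj₀
        have hj₀mem : j₀ ∈ G := Finset.min'_mem G hGne
        have hj₀le : ∀ j ∈ G, j₀ ≤ j := fun j hj => Finset.min'_le G j hj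
        set S := insert (ω (j₀ - 1)) (G.image fun j => ω (j + 1)) with hS
        have hSQ : S ⊆ Q := by
          intro x hx
          rw [hS, Finset.mem_insert] at hx
          rcases hx with rfl | hx
          · exact (hQmem j₀ hj₀mem).1
          · obtain ⟨j, hj, rfl⟩ := Finset.mem_image.1 hx
            exact (hQmem j hj).2
        have hnot : ω (j₀ - 1) ∉ G.image fun j => ω (j + 1) := by
          intro hx
          obtain ⟨j, hj, hjx⟩ := Finset.mem_image.1 hx
          have hjn := (hGmem j hj).1
          have hj0n := (hGmem j₀ hj₀mem).1
          have := hinj' (j + 1) (by omega) (j₀ - 1) (by omega) hjx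
          have := hj₀le j hj
          omega
        have hScard : S.card = G.card + 1 := by
          rw [hS, Finset.card_insert_of_notMem hnot, Finset.card_image_of_injOn]
          intro j hj j' hj' h
          rw [Finset.mem_coe] at hj hj'
          have := hinj' (j + 1) (by have := (hGmem j hj).1; omega) (j' + 1)
            (by have := (hGmem j' hj').1; omega) h
          simpa using this
        have := Finset.card_le_card hSQ
        omega
      omega
  omega

/-- **`cₙ ≤ cₙ₊₁` for every odd `n ≤ 6d - 5`, in every dimension**: by the reversal pairing
`count_le_count_succ_add_card_doublyTrapped` (`cₙ ≤ cₙ₊₁ + #T₂`) and `doublyTrapped_eq_empty_of_odd`.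
[cite: BDGS2012, §1.3] [cite: MadrasSlade1993, §7.1] -/
theorem count_le_count_succ_of_odd {n : ℕ} (hodd : Odd n) (hn : n + 5 ≤ 6 * d) :
    count d n ≤ count d (n + 1) := by
  have := count_le_count_succ_add_card_doublyTrapped d n
  rw [doublyTrapped_eq_empty_of_odd hodd hn, Finset.card_empty, add_zero] at this
  exact this

/-- **`cₙ ≤ cₙ₊₁` for all `n ≤ 6d - 4`, in every dimension `d ≥ 1`**: odd `n ≤ 6d - 5` by
`count_le_count_succ_of_odd`, even `n ≤ 6d - 4 ≤ 8d - 8` by `count_le_count_succ_of_even` (`d ≥ 2`), and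
`d = 1` by `count_one_le_count_one_succ`.  (`d = 2`: `n ≤ 8`; `d = 3`: `n ≤ 14`; `d = 4`: `n ≤ 20`.)
The general inequality is O'Brien's theorem, the tree's named fact `BDGS2012_count_mono`.
[cite: BDGS2012, §1.3] [cite: MadrasSlade1993, §7.1] -/
theorem count_le_count_succ_of_le_six_mul {n : ℕ} (hd : 1 ≤ d) (hn : n + 4 ≤ 6 * d) :
    count d n ≤ count d (n + 1) := by
  rcases Nat.lt_or_ge d 2 with hd1 | hd2
  · obtain rfl : d = 1 := by omega
    exact count_one_le_count_one_succ n
  rcases Nat.even_or_odd n with hev | hodd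
  · exact count_le_count_succ_of_even hev (by omega)
  · exact count_le_count_succ_of_odd hodd (by have := Nat.odd_iff.1 hodd; omega)

end Literature.Probability.RandomPlanarGeometry.SAW.Zd
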